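import Mathlib.Combinatorics.SimpleGraph.Finite
import Mathlib.Data.Fintype.Sum
import Mathlib.Data.Fintype.Prod
import Mathlib.Data.Fintype.Fin
import Mathlib.Tactic.Ring
import HarnessLib

/-!
# The TSP gadget graph: vertex type, edges, neighbourhoods

Support file for the discharge of `Literature.Barriers.PneNP.TSPExtensionComplexity` (FMPTW
2015, Thm. 12: `xc(TSP(n)) ≥ 2^{Ω(√n)}`). FMPTW's Lemma 11 embeds the correlation polytope
`COR(n)` into a face of `TSP(O(n²))` through the textbook 3SAT → directed-Hamiltonian-path
reduction, whose correctness ("the node `w_m` corresponding to a clause can be visited only if we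
satisfy it", PDF p. 11) is a global argument about Hamiltonian paths. For the formal proof we use
a DIFFERENT graph with the same effect (the unique-disjointness slack pattern on `2^n` tours and
`2^n` valid inequalities of `TSP(q)`, `q = 15n² + 2n + pad`), designed so that every fact about
its tours follows from two LOCAL properties of Hamiltonian cycles (degree two at each vertex; no
shorter sub-cycle): Papadimitriou-style **exclusive-or gadgets** (two 4-vertex rows `t₀…t₃`,
`s₀…s₃` joined through 4 middle vertices of degree two) hung between a **clique** of skeleton
vertices. This file only sets up the graph:

* `GV n pad` — the vertices: chain ends `g i side`, anchors `a i j c` (for `i < j` the triangle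
  `P, Q, R` of the pair; for `i = j` the two dummy anchors of the diagonal gadget and a free
  vertex; for `i > j` two buffers and a free vertex), gadget vertices `x i j r c` (gadget
  `X_(i,j)` for EVERY ordered pair, row `r` = top/middle/bottom, column `c < 4`), padding `d t`;
  `GV.card : |GV n pad| = 15 n² + 2 n + pad`.
* `gadgetGraph n pad` — skeleton vertices pairwise adjacent; gadget vertex `x i j 1 c` adjacent
  to `x i j 0 c` and `x i j 2 c` only; top vertex `x i j 0 c` adjacent to its middle vertex and
  its two row neighbours `tPrev`, `tNext` (the row ends hang on the anchors `ancL i j`,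
  `ancR i j`); bottom vertex `x i j 2 c` likewise with `sPrev`, `sNext` (the row ends continue
  the CHAIN of `i`: `g i false – X_(i,0) – X_(i,1) – ⋯ – X_(i,n-1) – g i true`).
* the neighbourhood characterisations `adj_mid_iff`, `adj_top_iff`, `adj_bot_iff` and the
  skeleton clique `adj_of_skel`, which are all that the tour analysis (sibling files
  `…GadgetXor.lean`, `…GadgetIneq.lean`, `…GadgetTours.lean`) uses.

The construction is ours (standard gadgetry, cf. Papadimitriou, *Computational Complexity*
(1994), §9.3, proof of Thm. 9.7); it replaces FMPTW Lemma 11 and is tagged [folklore].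
-/

namespace Literature.Barriers.PneNP

/-- Vertices of the gadget graph with parameters `n` (number of bits) and `pad` (padding).
[folklore] -/
inductive GV (n pad : ℕ) : Type
  /-- chain ends: `g i false` starts the chain of bit `i`, `g i true` ends it -/
  | g (i : Fin n) (side : Bool)
  /-- anchors / buffers / free skeleton vertices attached to the ordered pair `(i, j)` -/
  | a (i j : Fin n) (c : Fin 3)
  /-- vertex in row `r` (0 top, 1 middle, 2 bottom), column `c` of the XOR gadget `X_(i,j)` -/
  | x (i j : Fin n) (r : Fin 3) (c : Fin 4)
  /-- padding skeleton vertices -/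
  | d (t : Fin pad)
  deriving DecidableEq

namespace GV

variable {n pad : ℕ}

/-- `GV n pad` as a sum of products. [folklore] -/
def equivSum : GV n pad ≃
    (Fin n × Bool) ⊕ (Fin n × Fin n × Fin 3) ⊕ (Fin n × Fin n × Fin 3 × Fin 4) ⊕ Fin pad where
  toFun
    | g i s => Sum.inl (i, s)
    | a i j c => Sum.inr (Sum.inl (i, j, c))
    | x i j r c => Sum.inr (Sum.inr (Sum.inl (i, j, r, c)))
    | d t => Sum.inr (Sum.inr (Sum.inr t))
  invFun
    | Sum.inl (i, s) => g i s
    | Sum.inr (Sum.inl (i, j, c)) => a i j c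
    | Sum.inr (Sum.inr (Sum.inl (i, j, r, c))) => x i j r c
    | Sum.inr (Sum.inr (Sum.inr t)) => d t
  left_inv v := by cases v <;> rfl
  right_inv w := by rcases w with ⟨i, s⟩ | ⟨i, j, c⟩ | ⟨i, j, r, c⟩ | t <;> rfl

/-- `GV n pad` is finite (through `equivSum`). [folklore] -/
instance : Fintype (GV n pad) := Fintype.ofEquiv _ equivSum.symm

/-- `|GV n pad| = 2n + 3n² + 12n² + pad`. [folklore] -/
theorem card (n pad : ℕ) : Fintype.card (GV n pad) = 15 * n ^ 2 + 2 * n + pad := by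
  rw [Fintype.card_congr (equivSum (n := n) (pad := pad))]
  simp only [Fintype.card_sum, Fintype.card_prod, Fintype.card_fin, Fintype.card_bool]
  ring

/-- Skeleton vertices: all but the gadget vertices. [folklore] -/
def skel : GV n pad → Bool
  | x _ _ _ _ => false
  | _ => true

/-- Chain ends are skeleton. [folklore] -/
@[simp] theorem skel_g (i : Fin n) (s : Bool) : skel (g i s : GV n pad) = true := rfl
/-- Anchors are skeleton. [folklore] -/
@[simp] theorem skel_a (i j : Fin n) (c : Fin 3) : skel (a i j c : GV n pad) = true := rfl
/-- Gadget vertices are not skeleton. [folklore] -/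
@[simp] theorem skel_x (i j : Fin n) (r : Fin 3) (c : Fin 4) :
    skel (x i j r c : GV n pad) = false := rfl
/-- Padding is skeleton. [folklore] -/
@[simp] theorem skel_d (t : Fin pad) : skel (d t : GV n pad) = true := rfl

/-- Left anchor of the top row of `X_(i,j)`: `P` of the pair if `i < j`, `Q` of the pair
`(j,i)` if `i > j`, the first dummy anchor if `i = j`. [folklore] -/
def ancL (i j : Fin n) : GV n pad := if i ≤ j then a i j 0 else a j i 1

/-- Right anchor of the top row of `X_(i,j)`: `Q` if `i < j`, `R` of `(j,i)` if `i > j`, the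
second dummy anchor if `i = j`. [folklore] -/
def ancR (i j : Fin n) : GV n pad := if i ≤ j then a i j 1 else a j i 2

/-- Chain predecessor of the bottom row of `X_(i,j)`: `g i false` for `j = 0`, else the last
bottom vertex of `X_(i,j-1)`. [folklore] -/
def chL (i j : Fin n) : GV n pad :=
  if h : (j : ℕ) = 0 then g i false else x i ⟨(j : ℕ) - 1, by omega⟩ 2 3

/-- Chain successor of the bottom row of `X_(i,j)`: `g i true` for `j = n-1`, else the first
bottom vertex of `X_(i,j+1)`. [folklore] -/
def chR (i j : Fin n) : GV n pad :=
  if h : (j : ℕ) + 1 = n then g i true else x i ⟨(j : ℕ) + 1, by omega⟩ 2 0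

/-- Row predecessor of top vertex `c`. [folklore] -/
def tPrev (i j : Fin n) (c : Fin 4) : GV n pad :=
  if h : (c : ℕ) = 0 then ancL i j else x i j 0 ⟨(c : ℕ) - 1, by omega⟩

/-- Row successor of top vertex `c`. [folklore] -/
def tNext (i j : Fin n) (c : Fin 4) : GV n pad :=
  if h : (c : ℕ) = 3 then ancR i j else x i j 0 ⟨(c : ℕ) + 1, by omega⟩

/-- Row predecessor of bottom vertex `c`. [folklore] -/
def sPrev (i j : Fin n) (c : Fin 4) : GV n pad :=
  if h : (c : ℕ) = 0 then chL i j else x i j 2 ⟨(c : ℕ) - 1, by omega⟩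

/-- Row successor of bottom vertex `c`. [folklore] -/
def sNext (i j : Fin n) (c : Fin 4) : GV n pad :=
  if h : (c : ℕ) = 3 then chR i j else x i j 2 ⟨(c : ℕ) + 1, by omega⟩

/-- Structural adjacency OUT OF a gadget vertex (its two or three listed neighbours); `False`
out of skeleton vertices. [folklore] -/
def struct : GV n pad → GV n pad → Prop
  | x i j r c, w =>
      if (r : ℕ) = 1 then w = x i j 0 c ∨ w = x i j 2 c
      else if (r : ℕ) = 0 then w = x i j 1 c ∨ w = tPrev i j c ∨ w = tNext i j c
      else w = x i j 1 c ∨ w = sPrev i j c ∨ w = sNext i j c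
  | _, _ => False

/-- `struct` is decidable. [folklore] -/
instance structDecidable (v w : GV n pad) : Decidable (struct v w) := by
  cases v <;> simp only [struct] <;> infer_instance

/-- The list of a middle vertex. [folklore] -/
theorem struct_mid (i j : Fin n) (c : Fin 4) (w : GV n pad) :
    struct (x i j 1 c) w ↔ w = x i j 0 c ∨ w = x i j 2 c := by
  simp [struct]

/-- The list of a top vertex. [folklore] -/
theorem struct_top (i j : Fin n) (c : Fin 4) (w : GV n pad) :
    struct (x i j 0 c) w ↔ w = x i j 1 c ∨ w = tPrev i j c ∨ w = tNext i j c := by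
  simp [struct]

/-- The list of a bottom vertex. [folklore] -/
theorem struct_bot (i j : Fin n) (c : Fin 4) (w : GV n pad) :
    struct (x i j 2 c) w ↔ w = x i j 1 c ∨ w = sPrev i j c ∨ w = sNext i j c := by
  simp [struct]

/-- The relation generating the gadget graph: skeleton pairs and structural pairs. [folklore] -/
def rel (v w : GV n pad) : Prop := (skel v = true ∧ skel w = true) ∨ struct v w

/-- `rel` is decidable. [folklore] -/
instance relDecidable (v w : GV n pad) : Decidable (rel v w) := by
  unfold rel; infer_instance

end GV

open GV

/-- **The gadget graph.** Skeleton vertices form a clique; gadget vertices carry exactly their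
structural edges (symmetrised): `SimpleGraph.fromRel GV.rel`. [folklore] -/
def gadgetGraph (n pad : ℕ) : SimpleGraph (GV n pad) := SimpleGraph.fromRel GV.rel

/-- Adjacency of the gadget graph is decidable. [folklore] -/
instance (n pad : ℕ) : DecidableRel (gadgetGraph n pad).Adj := by
  unfold gadgetGraph; infer_instance

variable {n pad : ℕ}

/-- Adjacency of the gadget graph, unfolded. [folklore] -/
theorem gadgetGraph_adj {v w : GV n pad} :
    (gadgetGraph n pad).Adj v w ↔
      v ≠ w ∧ ((skel v = true ∧ skel w = true) ∨ struct v w ∨ struct w v) := by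
  rw [gadgetGraph, SimpleGraph.fromRel_adj]
  simp only [GV.rel]
  tauto

/-- The skeleton is a clique. [folklore] -/
theorem adj_of_skel {v w : GV n pad} (hv : skel v = true) (hw : skel w = true) (hne : v ≠ w) :
    (gadgetGraph n pad).Adj v w :=
  gadgetGraph_adj.2 ⟨hne, Or.inl ⟨hv, hw⟩⟩

/-- Listed structural neighbours are adjacent. [folklore] -/
theorem adj_of_struct {v w : GV n pad} (h : struct v w) (hne : v ≠ w) :
    (gadgetGraph n pad).Adj v w :=
  gadgetGraph_adj.2 ⟨hne, Or.inr (Or.inl h)⟩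

/-- … in either direction. [folklore] -/
theorem adj_of_struct' {v w : GV n pad} (h : struct w v) (hne : v ≠ w) :
    (gadgetGraph n pad).Adj v w :=
  gadgetGraph_adj.2 ⟨hne, Or.inr (Or.inr h)⟩

/-! ### Values of the auxiliary vertex functions -/

section aux

variable (i j : Fin n)

/-- Left anchors are skeleton. [folklore] -/
@[simp] theorem skel_ancL : skel (ancL i j : GV n pad) = true := by
  unfold ancL; split <;> rfl

/-- Right anchors are skeleton. [folklore] -/
@[simp] theorem skel_ancR : skel (ancR i j : GV n pad) = true := by
  unfold ancR; split <;> rfl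

/-- Left anchors are not gadget vertices. [folklore] -/
theorem ancL_ne_x (i' j' : Fin n) (r : Fin 3) (c : Fin 4) :
    (ancL i j : GV n pad) ≠ x i' j' r c := by
  unfold ancL; split <;> simp

/-- Right anchors are not gadget vertices. [folklore] -/
theorem ancR_ne_x (i' j' : Fin n) (r : Fin 3) (c : Fin 4) :
    (ancR i j : GV n pad) ≠ x i' j' r c := by
  unfold ancR; split <;> simp

/-- When the chain predecessor is a gadget vertex. [folklore] -/
theorem chL_eq_x_iff (i' j' : Fin n) (r : Fin 3) (c : Fin 4) :
    (chL i j : GV n pad) = x i' j' r c ↔ i' = i ∧ (j' : ℕ) + 1 = j ∧ r = 2 ∧ c = 3 := by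
  unfold chL
  split_ifs with h
  · constructor
    · intro h'
      exact absurd h' (by simp)
    · rintro ⟨-, h', -, -⟩
      omega
  · constructor
    · intro h'
      simp only [GV.x.injEq] at h'
      obtain ⟨rfl, rfl, rfl, rfl⟩ := h'
      exact ⟨rfl, by simp only; omega, rfl, rfl⟩
    · rintro ⟨rfl, h', rfl, rfl⟩
      simp only [GV.x.injEq, true_and, and_true]
      exact Fin.ext (by simp only; omega)

/-- When the chain successor is a gadget vertex. [folklore] -/
theorem chR_eq_x_iff (i' j' : Fin n) (r : Fin 3) (c : Fin 4) :
    (chR i j : GV n pad) = x i' j' r c ↔ i' = i ∧ (j' : ℕ) = j + 1 ∧ r = 2 ∧ c = 0 := by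
  unfold chR
  split_ifs with h
  · constructor
    · intro h'
      exact absurd h' (by simp)
    · rintro ⟨-, h', -, -⟩
      omega
  · constructor
    · intro h'
      simp only [GV.x.injEq] at h'
      obtain ⟨rfl, rfl, rfl, rfl⟩ := h'
      exact ⟨rfl, rfl, rfl, rfl⟩
    · rintro ⟨rfl, h', rfl, rfl⟩
      simp only [GV.x.injEq, true_and, and_true]
      exact Fin.ext h'.symm

/-- When the top-row predecessor is a gadget vertex. [folklore] -/
theorem tPrev_eq_x_iff (c : Fin 4) (i' j' : Fin n) (r : Fin 3) (c' : Fin 4) :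
    (tPrev i j c : GV n pad) = x i' j' r c' ↔ i' = i ∧ j' = j ∧ r = 0 ∧ (c' : ℕ) + 1 = c := by
  unfold tPrev
  split_ifs with h
  · constructor
    · intro h'
      exact absurd h' (ancL_ne_x _ _ _ _ _ _)
    · rintro ⟨-, -, -, h'⟩
      omega
  · constructor
    · intro h'
      simp only [GV.x.injEq] at h'
      obtain ⟨rfl, rfl, rfl, rfl⟩ := h'
      exact ⟨rfl, rfl, rfl, by simp only; omega⟩
    · rintro ⟨rfl, rfl, rfl, h'⟩
      simp only [GV.x.injEq, true_and]
      exact Fin.ext (by simp only; omega)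

/-- When the top-row successor is a gadget vertex. [folklore] -/
theorem tNext_eq_x_iff (c : Fin 4) (i' j' : Fin n) (r : Fin 3) (c' : Fin 4) :
    (tNext i j c : GV n pad) = x i' j' r c' ↔ i' = i ∧ j' = j ∧ r = 0 ∧ (c' : ℕ) = c + 1 := by
  unfold tNext
  split_ifs with h
  · constructor
    · intro h'
      exact absurd h' (ancR_ne_x _ _ _ _ _ _)
    · rintro ⟨-, -, -, h'⟩
      omega
  · constructor
    · intro h'
      simp only [GV.x.injEq] at h'
      obtain ⟨rfl, rfl, rfl, rfl⟩ := h'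
      exact ⟨rfl, rfl, rfl, rfl⟩
    · rintro ⟨rfl, rfl, rfl, h'⟩
      simp only [GV.x.injEq, true_and]
      exact Fin.ext h'.symm

/-- When the bottom-row predecessor is a gadget vertex. [folklore] -/
theorem sPrev_eq_x_iff (c : Fin 4) (i' j' : Fin n) (r : Fin 3) (c' : Fin 4) :
    (sPrev i j c : GV n pad) = x i' j' r c' ↔
      ((c : ℕ) = 0 ∧ i' = i ∧ (j' : ℕ) + 1 = j ∧ r = 2 ∧ c' = 3) ∨
      ((c : ℕ) ≠ 0 ∧ i' = i ∧ j' = j ∧ r = 2 ∧ (c' : ℕ) + 1 = c) := by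
  unfold sPrev
  split_ifs with h
  · rw [chL_eq_x_iff]
    simp [h]
  · simp only [h, false_and, false_or, ne_eq, not_false_eq_true, true_and]
    constructor
    · intro h'
      simp only [GV.x.injEq] at h'
      obtain ⟨rfl, rfl, rfl, rfl⟩ := h'
      exact ⟨rfl, rfl, rfl, by simp only; omega⟩
    · rintro ⟨rfl, rfl, rfl, h'⟩
      simp only [GV.x.injEq, true_and]
      exact Fin.ext (by simp only; omega)

/-- When the bottom-row successor is a gadget vertex. [folklore] -/
theorem sNext_eq_x_iff (c : Fin 4) (i' j' : Fin n) (r : Fin 3) (c' : Fin 4) :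
    (sNext i j c : GV n pad) = x i' j' r c' ↔
      ((c : ℕ) = 3 ∧ i' = i ∧ (j' : ℕ) = j + 1 ∧ r = 2 ∧ c' = 0) ∨
      ((c : ℕ) ≠ 3 ∧ i' = i ∧ j' = j ∧ r = 2 ∧ (c' : ℕ) = c + 1) := by
  unfold sNext
  split_ifs with h
  · rw [chR_eq_x_iff]
    simp [h]
  · simp only [h, false_and, false_or, ne_eq, not_false_eq_true, true_and]
    constructor
    · intro h'
      simp only [GV.x.injEq] at h'
      obtain ⟨rfl, rfl, rfl, rfl⟩ := h'
      exact ⟨rfl, rfl, rfl, rfl⟩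
    · rintro ⟨rfl, rfl, rfl, h'⟩
      simp only [GV.x.injEq, true_and]
      exact Fin.ext h'.symm

end aux

/-! ### Symmetry of the structural adjacency and the neighbourhoods of gadget vertices -/

/-- A gadget vertex with row value `k` is `x i j k c`. [folklore] -/
theorem x_eq_of_val {i j : Fin n} {r : Fin 3} {c : Fin 4} {k : ℕ} (hk : k < 3)
    (hr : (r : ℕ) = k) : (x i j r c : GV n pad) = x i j ⟨k, hk⟩ c := by
  congr; exact Fin.ext hr

/-- Structural adjacency INTO a gadget vertex comes from a listed neighbour of it. [folklore] -/
theorem struct_symm {w : GV n pad} {i j : Fin n} {r : Fin 3} {c : Fin 4}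
    (h : struct w (x i j r c)) : struct (x i j r c) w := by
  -- `w` is a gadget vertex
  obtain ⟨i', j', r', c', rfl⟩ : ∃ i' j' r' c', w = x i' j' r' c' := by
    cases w with
    | x i' j' r' c' => exact ⟨i', j', r', c', rfl⟩
    | _ => all_goals simp [struct] at h
  -- analyse the row of `w`
  have hr' : (r' : ℕ) = 0 ∨ (r' : ℕ) = 1 ∨ (r' : ℕ) = 2 := by omega
  rcases hr' with hr' | hr' | hr'
  · -- `w` is a top vertex
    rw [x_eq_of_val (by norm_num) hr'] at h ⊢
    change struct (x i' j' 0 c') _ at h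
    rw [struct_top] at h
    rcases h with h | h | h
    · simp only [GV.x.injEq] at h
      obtain ⟨rfl, rfl, rfl, rfl⟩ := h
      exact (struct_mid _ _ _ _).2 (Or.inl rfl)
    · obtain ⟨rfl, rfl, rfl, hc⟩ := (tPrev_eq_x_iff _ _ _ _ _ _ _).1 h.symm
      refine (struct_top _ _ _ _).2 (Or.inr (Or.inr ?_))
      symm
      rw [tNext_eq_x_iff]
      exact ⟨rfl, rfl, rfl, by omega⟩
    · obtain ⟨rfl, rfl, rfl, hc⟩ := (tNext_eq_x_iff _ _ _ _ _ _ _).1 h.symm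
      refine (struct_top _ _ _ _).2 (Or.inr (Or.inl ?_))
      symm
      rw [tPrev_eq_x_iff]
      exact ⟨rfl, rfl, rfl, by omega⟩
  · -- `w` is a middle vertex
    rw [x_eq_of_val (by norm_num) hr'] at h ⊢
    change struct (x i' j' 1 c') _ at h
    rw [struct_mid] at h
    rcases h with h | h
    · simp only [GV.x.injEq] at h
      obtain ⟨rfl, rfl, rfl, rfl⟩ := h
      exact (struct_top _ _ _ _).2 (Or.inl rfl)
    · simp only [GV.x.injEq] at h
      obtain ⟨rfl, rfl, rfl, rfl⟩ := h
      exact (struct_bot _ _ _ _).2 (Or.inl rfl)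
  · -- `w` is a bottom vertex
    rw [x_eq_of_val (by norm_num) hr'] at h ⊢
    change struct (x i' j' 2 c') _ at h
    rw [struct_bot] at h
    rcases h with h | h | h
    · simp only [GV.x.injEq] at h
      obtain ⟨rfl, rfl, rfl, rfl⟩ := h
      exact (struct_mid _ _ _ _).2 (Or.inr rfl)
    · rcases (sPrev_eq_x_iff _ _ _ _ _ _ _).1 h.symm with
        ⟨hc', rfl, hj, rfl, rfl⟩ | ⟨-, rfl, rfl, rfl, hc⟩
      · -- chain link: `w = x i j' 2 0` with `j' = j + 1`, `v = x i j 2 3`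
        refine (struct_bot _ _ _ _).2 (Or.inr (Or.inr ?_))
        symm
        rw [sNext_eq_x_iff]
        exact Or.inl ⟨rfl, rfl, by omega, rfl, Fin.ext hc'⟩
      · refine (struct_bot _ _ _ _).2 (Or.inr (Or.inr ?_))
        symm
        rw [sNext_eq_x_iff]
        exact Or.inr ⟨by omega, rfl, rfl, rfl, by omega⟩
    · rcases (sNext_eq_x_iff _ _ _ _ _ _ _).1 h.symm with
        ⟨hc', rfl, hj, rfl, rfl⟩ | ⟨-, rfl, rfl, rfl, hc⟩
      · refine (struct_bot _ _ _ _).2 (Or.inr (Or.inl ?_))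
        symm
        rw [sPrev_eq_x_iff]
        exact Or.inl ⟨rfl, rfl, by omega, rfl, Fin.ext hc'⟩
      · refine (struct_bot _ _ _ _).2 (Or.inr (Or.inl ?_))
        symm
        rw [sPrev_eq_x_iff]
        exact Or.inr ⟨by omega, rfl, rfl, rfl, by omega⟩

/-- No gadget vertex lists itself. [folklore] -/
theorem not_struct_self {i j : Fin n} {r : Fin 3} {c : Fin 4} :
    ¬struct (x i j r c : GV n pad) (x i j r c) := by
  intro h
  have hr : (r : ℕ) = 0 ∨ (r : ℕ) = 1 ∨ (r : ℕ) = 2 := by omega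
  rcases hr with hr | hr | hr
  · rw [x_eq_of_val (by norm_num) hr] at h
    change struct (x i j 0 c) _ at h
    rw [struct_top] at h
    rcases h with h | h | h
    · simp at h
    · obtain ⟨-, -, -, h⟩ := (tPrev_eq_x_iff _ _ _ _ _ _ _).1 h.symm
      omega
    · obtain ⟨-, -, -, h⟩ := (tNext_eq_x_iff _ _ _ _ _ _ _).1 h.symm
      omega
  · rw [x_eq_of_val (by norm_num) hr] at h
    change struct (x i j 1 c) _ at h
    rw [struct_mid] at h
    rcases h with h | h <;> simp at h
  · rw [x_eq_of_val (by norm_num) hr] at h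
    change struct (x i j 2 c) _ at h
    rw [struct_bot] at h
    rcases h with h | h | h
    · simp at h
    · rcases (sPrev_eq_x_iff _ _ _ _ _ _ _).1 h.symm with ⟨-, -, h, -, -⟩ | ⟨-, -, -, -, h⟩ <;>
        omega
    · rcases (sNext_eq_x_iff _ _ _ _ _ _ _).1 h.symm with ⟨-, -, h, -, -⟩ | ⟨-, -, -, -, h⟩ <;>
        omega

/-- Adjacency out of a gadget vertex is exactly structural adjacency. [folklore] -/
theorem adj_x_iff {i j : Fin n} {r : Fin 3} {c : Fin 4} {w : GV n pad} :
    (gadgetGraph n pad).Adj (x i j r c) w ↔ struct (x i j r c) w := by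
  rw [gadgetGraph_adj]
  constructor
  · rintro ⟨_, h | h | h⟩
    · simp at h
    · exact h
    · exact struct_symm h
  · intro h
    refine ⟨?_, Or.inr (Or.inl h)⟩
    rintro rfl
    exact not_struct_self h

/-- **Neighbourhood of a middle vertex**: its top and bottom vertex. [folklore] -/
theorem adj_mid_iff {i j : Fin n} {c : Fin 4} {w : GV n pad} :
    (gadgetGraph n pad).Adj (x i j 1 c) w ↔ w = x i j 0 c ∨ w = x i j 2 c := by
  rw [adj_x_iff, struct_mid]

/-- **Neighbourhood of a top vertex**: its middle vertex and its two row neighbours.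
[folklore] -/
theorem adj_top_iff {i j : Fin n} {c : Fin 4} {w : GV n pad} :
    (gadgetGraph n pad).Adj (x i j 0 c) w ↔ w = x i j 1 c ∨ w = tPrev i j c ∨ w = tNext i j c := by
  rw [adj_x_iff, struct_top]

/-- **Neighbourhood of a bottom vertex**: its middle vertex and its two row/chain neighbours.
[folklore] -/
theorem adj_bot_iff {i j : Fin n} {c : Fin 4} {w : GV n pad} :
    (gadgetGraph n pad).Adj (x i j 2 c) w ↔ w = x i j 1 c ∨ w = sPrev i j c ∨ w = sNext i j c := by
  rw [adj_x_iff, struct_bot]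

/-- A skeleton vertex is adjacent to a gadget vertex only through the gadget's list.
[folklore] -/
theorem struct_of_adj_skel {v w : GV n pad} (hv : skel v = true) (hw : skel w = false)
    (h : (gadgetGraph n pad).Adj v w) : struct w v := by
  rcases (gadgetGraph_adj.1 h).2 with h' | h' | h'
  · rw [hw] at h'; exact absurd h'.2 (by simp)
  · cases v <;> simp_all [struct]
  · exact h'

end Literature.Barriers.PneNP
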